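import Mathlib.Analysis.SpecialFunctions.Integrals.Basic
import Mathlib.MeasureTheory.Integral.IntervalIntegral.Basic
import Mathlib.Analysis.SpecialFunctions.Complex.Circle
import HarnessLib

/-!
# Products of Fejér kernels and their mean values (the weight of Anderson–Stark)

Topic `Literature/NumberTheory/LFunctions`; namespace `Literature.NumberTheory.LFunctions.AndersonStark`. Purely
trigonometric-polynomial material used to discharge Best–Trudgian 2015, Theorem 2 (Anderson–Stark
1981) for the Mertens function (`Literature/Barriers/RiemannHypothesis/BestTrudgian2015Proofs.lean`)
through the abstract averaging theorem of `InghamSmoothingAveraging.lean`: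

* `fejerPoly N x = Σ_{|c| ≤ N} (1 − |c|/(N+1)) e^{icx}` and Fejér's identity
  `fejerPoly N x = (N+1)⁻¹ |Σ_{m=0}^{N} e^{imx}|²` (`fejerPoly_eq`), so it is real and `≥ 0`;
* the Anderson–Stark weight `fejerProd N λ θ y = Π_j (N_j+1)⁻¹ |Σ_{m ≤ N_j} e^{im(λ_j y + θ_j)}|²`
  (real, non-negative, continuous) and its expansion as a trigonometric polynomial
  `Σ_{c ∈ Π_j [−N_j, N_j]} W_c e^{i(Σ_j c_jλ_j)y}`, `W_c = Π_j (1 − |c_j|/(N_j+1)) · e^{iΣ_j c_jθ_j}`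
  (`fejerProd_eq_sum`);
* interval means of exponentials, `U⁻¹∫_Y^{Y+U} e^{iνy} dy → [ν = 0]` (`tendsto_mean_cexp`), of
  finite trigonometric sums (`tendsto_mean_trigSum`), and hence of `fejerProd` and of
  `fejerProd · Re S` for `S(y) = Σᵢ bᵢ e^{iγᵢ y}` (`tendsto_mean_fejerProd`,
  `tendsto_mean_fejerProd_mul_re`): the limits are the sums of the coefficients of the
  zero-frequency terms, `Σ_{c : Σ c_jλ_j = 0} W_c` and `Σᵢ Σ_{c : Σ c_jλ_j + γᵢ = 0} W_c bᵢ`.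

Which terms have frequency zero is decided, in the application, by the `{N_γ}`-independence of
the `λ_j` (Best–Trudgian 2015, Definition 1); nothing about that, or about `ζ`, is assumed here.

## References

* [BestTrudgian2015] D. G. Best, T. S. Trudgian, *Linear relations of zeroes of the
  zeta-function*, Math. Comp. 84 (2015), §2 (Theorem 2, after R. J. Anderson, H. M. Stark,
  *Oscillation theorems*, LNM 899 (1981), and Ingham 1942), read from arXiv:1209.3843 — the
  source of the method; the Fejér-product averaging itself is classical (Ingham 1942, §§3–4).
-/

noncomputable section

open Complex Filter MeasureTheory Set Topology Finset

namespace Literature.NumberTheory.LFunctions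
namespace AndersonStark

/-! ## Fejér's kernel as a trigonometric polynomial -/

/-- Fejér's weight `1 − |c|/(N+1)`. [folklore] -/
def fejerWeight (N : ℕ) (c : ℤ) : ℝ := 1 - |(c : ℝ)| / (N + 1)

/-- Fejér's kernel of order `N` as a trigonometric polynomial,
`F_N(x) = Σ_{c=−N}^{N} (1 − |c|/(N+1)) e^{icx}`. [folklore] -/
def fejerPoly (N : ℕ) (x : ℝ) : ℂ :=
  ∑ c ∈ Finset.Icc (-(N : ℤ)) N, (fejerWeight N c : ℂ) * cexp ((((c : ℝ) * x : ℝ) : ℂ) * I)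

/-- The number of pairs `(m, m') ∈ [0, N]²` with `m − m' = d` is `N + 1 − |d|` (`|d| ≤ N`).
[folklore] -/
theorem card_filter_sub_eq (N : ℕ) {d : ℤ} (hd : |d| ≤ N) :
    (((Finset.range (N + 1)) ×ˢ (Finset.range (N + 1))).filter
        fun p : ℕ × ℕ ↦ (p.1 : ℤ) - p.2 = d).card = N + 1 - d.natAbs := by
  rcases le_or_gt 0 d with h0 | h0
  · -- `d ≥ 0`: pairs `(t + d, t)`, `t < N + 1 - d`
    lift d to ℕ using h0
    have hdN : d ≤ N := by exact_mod_cast (abs_of_nonneg (by positivity : (0 : ℤ) ≤ d) ▸ hd)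
    rw [Int.natAbs_natCast]
    have : ((Finset.range (N + 1)) ×ˢ (Finset.range (N + 1))).filter
        (fun p : ℕ × ℕ ↦ (p.1 : ℤ) - p.2 = (d : ℤ)) =
        (Finset.range (N + 1 - d)).image fun t ↦ (t + d, t) := by
      ext ⟨m, m'⟩
      simp only [Finset.mem_filter, Finset.mem_product, Finset.mem_range, Finset.mem_image,
        Prod.mk.injEq]
      constructor
      · rintro ⟨⟨hm, hm'⟩, h⟩
        refine ⟨m', by omega, by omega, rfl⟩
      · rintro ⟨t, ht, rfl, rfl⟩
        exact ⟨⟨by omega, by omega⟩, by push_cast; ring⟩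
    rw [this, Finset.card_image_of_injective _ fun t₁ t₂ h ↦ by simpa using h,
      Finset.card_range]
  · -- `d < 0`: pairs `(t, t + |d|)`
    obtain ⟨e, rfl⟩ : ∃ e : ℕ, d = -(e : ℤ) := ⟨d.natAbs, by omega⟩
    have he : e ≤ N := by
      rw [abs_neg, Nat.abs_cast] at hd
      exact_mod_cast hd
    rw [Int.natAbs_neg, Int.natAbs_natCast]
    have : ((Finset.range (N + 1)) ×ˢ (Finset.range (N + 1))).filter
        (fun p : ℕ × ℕ ↦ (p.1 : ℤ) - p.2 = -(e : ℤ)) =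
        (Finset.range (N + 1 - e)).image fun t ↦ (t, t + e) := by
      ext ⟨m, m'⟩
      simp only [Finset.mem_filter, Finset.mem_product, Finset.mem_range, Finset.mem_image,
        Prod.mk.injEq]
      constructor
      · rintro ⟨⟨hm, hm'⟩, h⟩
        refine ⟨m, by omega, rfl, by omega⟩
      · rintro ⟨t, ht, rfl, rfl⟩
        exact ⟨⟨by omega, by omega⟩, by push_cast; ring⟩
    rw [this, Finset.card_image_of_injective _ fun t₁ t₂ h ↦ by simpa using h,
      Finset.card_range]

/-- **Fejér's identity**: `Σ_{|c| ≤ N} (1 − |c|/(N+1)) e^{icx} = (N+1)⁻¹ |Σ_{m=0}^{N} e^{imx}|²`; in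
particular `fejerPoly N x` is real and non-negative. [folklore] -/
theorem fejerPoly_eq (N : ℕ) (x : ℝ) :
    fejerPoly N x = ((((N : ℝ) + 1)⁻¹ *
      ‖∑ m ∈ Finset.range (N + 1), cexp ((((m : ℝ) * x : ℝ) : ℂ) * I)‖ ^ 2 : ℝ) : ℂ) := by
  set T : ℂ := ∑ m ∈ Finset.range (N + 1), cexp ((((m : ℝ) * x : ℝ) : ℂ) * I) with hT
  -- `|T|² = T · conj T = Σ_{m,m'} e^{i(m-m')x}`
  have hconj : (starRingEnd ℂ) T = ∑ m ∈ Finset.range (N + 1), cexp (-((((m : ℝ) * x : ℝ) : ℂ) * I)) := by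
    rw [hT, map_sum]
    refine Finset.sum_congr rfl fun m _ ↦ ?_
    rw [← Complex.exp_conj, map_mul, Complex.conj_ofReal, Complex.conj_I, mul_neg]
  have hsq : ((‖T‖ ^ 2 : ℝ) : ℂ) = ∑ p ∈ Finset.range (N + 1) ×ˢ Finset.range (N + 1),
      cexp (((((p.1 : ℤ) - p.2 : ℤ) : ℝ) * x : ℝ) * I) := by
    rw [← Complex.normSq_eq_norm_sq, ← Complex.mul_conj, hconj, hT,
      Finset.sum_mul_sum, Finset.sum_product]
    refine Finset.sum_congr rfl fun m _ ↦ Finset.sum_congr rfl fun m' _ ↦ ?_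
    rw [← Complex.exp_add]
    congr 1
    push_cast
    ring
  -- regroup by `d = m - m'`
  have hfib : ∑ p ∈ Finset.range (N + 1) ×ˢ Finset.range (N + 1),
      cexp (((((p.1 : ℤ) - p.2 : ℤ) : ℝ) * x : ℝ) * I) =
      ∑ d ∈ Finset.Icc (-(N : ℤ)) N, ((N + 1 - d.natAbs : ℕ) : ℂ) *
        cexp ((((d : ℝ) * x : ℝ) : ℂ) * I) := by
    rw [← Finset.sum_fiberwise_of_maps_to (s := Finset.range (N + 1) ×ˢ Finset.range (N + 1))
      (t := Finset.Icc (-(N : ℤ)) N) (g := fun p : ℕ × ℕ ↦ (p.1 : ℤ) - p.2)]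
    · refine Finset.sum_congr rfl fun d hd ↦ ?_
      have hd' : |d| ≤ N := by
        rw [Finset.mem_Icc] at hd
        exact abs_le.2 ⟨hd.1, hd.2⟩
      rw [Finset.sum_congr rfl (g := fun _ ↦ cexp ((((d : ℝ) * x : ℝ) : ℂ) * I))
        fun p hp ↦ by rw [(Finset.mem_filter.1 hp).2], Finset.sum_const, nsmul_eq_mul,
        card_filter_sub_eq N hd']
    · intro p hp
      rw [Finset.mem_product, Finset.mem_range, Finset.mem_range] at hp
      rw [Finset.mem_Icc]
      omega
  rw [Complex.ofReal_mul, hsq, hfib, Finset.mul_sum, fejerPoly]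
  refine Finset.sum_congr rfl fun d hd ↦ ?_
  rw [← mul_assoc]
  congr 1
  have hle : d.natAbs ≤ N + 1 := by
    rw [Finset.mem_Icc] at hd
    omega
  have hN : (N : ℝ) + 1 ≠ 0 := by positivity
  have key : fejerWeight N d = ((N : ℝ) + 1)⁻¹ * ((N + 1 - d.natAbs : ℕ) : ℝ) := by
    rw [fejerWeight, Nat.cast_sub hle, Nat.cast_natAbs, Int.cast_abs]
    push_cast
    field_simp
  rw [key]
  push_cast
  ring

/-- `fejerPoly N x` is a non-negative real number. [folklore] -/
theorem fejerPoly_re_nonneg (N : ℕ) (x : ℝ) : 0 ≤ (fejerPoly N x).re := by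
  rw [fejerPoly_eq, Complex.ofReal_re]
  positivity

/-! ## The Anderson–Stark weight: a product of Fejér kernels -/

section Prod

variable {κ : Type*} [Fintype κ]

/-- The box of coefficient vectors `c` with `|c_j| ≤ N_j`. [folklore] -/
def coeffBox [DecidableEq κ] (N : κ → ℕ) : Finset (κ → ℤ) :=
  Fintype.piFinset fun j ↦ Finset.Icc (-(N j : ℤ)) (N j)

/-- Membership in the box. [folklore] -/
theorem mem_coeffBox [DecidableEq κ] {N : κ → ℕ} {c : κ → ℤ} :
    c ∈ coeffBox N ↔ ∀ j, |c j| ≤ N j := by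
  simp [coeffBox, Fintype.mem_piFinset, abs_le]

/-- The frequency `Σ_j c_j λ_j` of the term indexed by `c`. [folklore] -/
def freq (lam : κ → ℝ) (c : κ → ℤ) : ℝ := ∑ j, (c j : ℝ) * lam j

/-- The coefficient `W_c = Π_j (1 − |c_j|/(N_j+1)) · e^{iΣ_j c_jθ_j}` of that term. [folklore] -/
def prodWeight (N : κ → ℕ) (θ : κ → ℝ) (c : κ → ℤ) : ℂ :=
  (∏ j, (fejerWeight (N j) (c j) : ℂ)) * cexp (((∑ j, (c j : ℝ) * θ j : ℝ) : ℂ) * I)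

/-- **The Anderson–Stark weight** `Q(y) = Π_j F_{N_j}(λ_j y + θ_j)`, written through Fejér's
identity as the manifestly non-negative `Π_j (N_j+1)⁻¹ |Σ_{m=0}^{N_j} e^{im(λ_j y + θ_j)}|²`.
[cite: BestTrudgian2015, Theorem 2 (proof)] -/
def fejerProd (N : κ → ℕ) (lam θ : κ → ℝ) (y : ℝ) : ℝ :=
  ∏ j, (((N j : ℝ) + 1)⁻¹ *
    ‖∑ m ∈ Finset.range (N j + 1), cexp ((((m : ℝ) * (lam j * y + θ j) : ℝ) : ℂ) * I)‖ ^ 2)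

/-- `Q ≥ 0`. [folklore] -/
theorem fejerProd_nonneg (N : κ → ℕ) (lam θ : κ → ℝ) (y : ℝ) : 0 ≤ fejerProd N lam θ y :=
  Finset.prod_nonneg fun j _ ↦ by positivity

/-- `Q` is continuous. [folklore] -/
theorem continuous_fejerProd (N : κ → ℕ) (lam θ : κ → ℝ) : Continuous (fejerProd N lam θ) := by
  unfold fejerProd
  fun_prop

/-- `Q(y) = Π_j F_{N_j}(λ_j y + θ_j)` with `F_N = fejerPoly N`. [folklore] -/
theorem ofReal_fejerProd (N : κ → ℕ) (lam θ : κ → ℝ) (y : ℝ) :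
    (fejerProd N lam θ y : ℂ) = ∏ j, fejerPoly (N j) (lam j * y + θ j) := by
  rw [fejerProd, Complex.ofReal_prod]
  exact Finset.prod_congr rfl fun j _ ↦ (fejerPoly_eq (N j) _).symm

/-- **Expansion of the weight as a trigonometric polynomial**:
`Q(y) = Σ_{c ∈ Π[−N_j,N_j]} W_c e^{i(Σ_j c_jλ_j) y}`. [folklore] -/
theorem fejerProd_eq_sum [DecidableEq κ] (N : κ → ℕ) (lam θ : κ → ℝ) (y : ℝ) :
    (fejerProd N lam θ y : ℂ) =
      ∑ c ∈ coeffBox N, prodWeight N θ c * cexp (((freq lam c * y : ℝ) : ℂ) * I) := by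
  rw [ofReal_fejerProd]
  simp only [fejerPoly]
  rw [Finset.prod_univ_sum]
  refine Finset.sum_congr rfl fun c _ ↦ ?_
  rw [Finset.prod_mul_distrib, prodWeight, mul_assoc, ← Complex.exp_add, ← Complex.exp_sum]
  congr 2
  simp only [freq]
  push_cast
  rw [Finset.sum_mul, Finset.sum_mul, Finset.sum_mul, ← Finset.sum_add_distrib]
  exact Finset.sum_congr rfl fun j _ ↦ by ring

end Prod

/-! ## Interval means of exponentials and of trigonometric sums -/

/-- `∫_a^b e^{iνy} dy = (e^{iνb} − e^{iνa})/(iν)` for `ν ≠ 0`. [folklore] -/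
theorem integral_cexp_mul_I {ν : ℝ} (hν : ν ≠ 0) (a b : ℝ) :
    ∫ y in a..b, cexp (((ν * y : ℝ) : ℂ) * I) =
      (cexp (((ν * b : ℝ) : ℂ) * I) - cexp (((ν * a : ℝ) : ℂ) * I)) / ((ν : ℂ) * I) := by
  have hc : (ν : ℂ) * I ≠ 0 := mul_ne_zero (Complex.ofReal_ne_zero.2 hν) Complex.I_ne_zero
  have h := integral_exp_mul_complex (a := a) (b := b) hc
  have hfun : (fun y : ℝ ↦ cexp (((ν * y : ℝ) : ℂ) * I)) = fun y : ℝ ↦ cexp ((ν : ℂ) * I * y) := by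
    funext y; congr 1; push_cast; ring
  rw [hfun, h]
  congr 2 <;> (congr 1; push_cast; ring)

/-- `|∫_a^b e^{iνy} dy| ≤ 2/|ν|`. [folklore] -/
theorem norm_integral_cexp_mul_I_le {ν : ℝ} (hν : ν ≠ 0) (a b : ℝ) :
    ‖∫ y in a..b, cexp (((ν * y : ℝ) : ℂ) * I)‖ ≤ 2 / |ν| := by
  rw [integral_cexp_mul_I hν, norm_div, norm_mul, Complex.norm_real, Complex.norm_I, mul_one,
    Real.norm_eq_abs]
  gcongr
  calc ‖cexp (((ν * b : ℝ) : ℂ) * I) - cexp (((ν * a : ℝ) : ℂ) * I)‖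
      ≤ ‖cexp (((ν * b : ℝ) : ℂ) * I)‖ + ‖cexp (((ν * a : ℝ) : ℂ) * I)‖ := norm_sub_le _ _
    _ = 2 := by rw [Complex.norm_exp_ofReal_mul_I, Complex.norm_exp_ofReal_mul_I]; norm_num

/-- **Mean values of exponentials**: `U⁻¹ ∫_Y^{Y+U} e^{iνy} dy → [ν = 0]` as `U → ∞`.
[folklore] -/
theorem tendsto_mean_cexp (ν Y : ℝ) :
    Tendsto (fun U : ℝ ↦ ((U : ℂ))⁻¹ * ∫ y in Y..Y + U, cexp (((ν * y : ℝ) : ℂ) * I)) atTop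
      (𝓝 (if ν = 0 then 1 else 0)) := by
  split_ifs with hν
  · subst hν
    refine tendsto_const_nhds.congr' ?_
    filter_upwards [eventually_ne_atTop 0] with U hU
    have hU' : (U : ℂ) ≠ 0 := Complex.ofReal_ne_zero.2 hU
    simp [hU']
  · rw [tendsto_zero_iff_norm_tendsto_zero]
    have hbound : ∀ U : ℝ, 0 < U →
        ‖((U : ℂ))⁻¹ * ∫ y in Y..Y + U, cexp (((ν * y : ℝ) : ℂ) * I)‖ ≤ 2 / |ν| * U⁻¹ := by
      intro U hU
      rw [norm_mul, norm_inv, Complex.norm_real, Real.norm_eq_abs, abs_of_pos hU, mul_comm]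
      exact mul_le_mul_of_nonneg_right (norm_integral_cexp_mul_I_le hν _ _) (inv_nonneg.2 hU.le)
    have h0 : Tendsto (fun U : ℝ ↦ 2 / |ν| * U⁻¹) atTop (𝓝 0) := by
      simpa using tendsto_inv_atTop_zero.const_mul (2 / |ν|)
    exact squeeze_zero' (Eventually.of_forall fun U ↦ norm_nonneg _)
      ((eventually_gt_atTop 0).mono hbound) h0

/-- **Mean values of finite trigonometric sums**: `U⁻¹ ∫_Y^{Y+U} Σ_l b_l e^{iν_l y} dy` tends to
the sum of the coefficients of the zero-frequency terms. [folklore] -/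
theorem tendsto_mean_trigSum {σ : Type*} (L : Finset σ) (b : σ → ℂ) (ν : σ → ℝ) (Y : ℝ) :
    Tendsto (fun U : ℝ ↦ ((U : ℂ))⁻¹ *
        ∫ y in Y..Y + U, ∑ l ∈ L, b l * cexp (((ν l * y : ℝ) : ℂ) * I))
      atTop (𝓝 (∑ l ∈ L with ν l = 0, b l)) := by
  have heq : ∀ U : ℝ, ((U : ℂ))⁻¹ * ∫ y in Y..Y + U, ∑ l ∈ L, b l * cexp (((ν l * y : ℝ) : ℂ) * I) =
      ∑ l ∈ L, b l * (((U : ℂ))⁻¹ * ∫ y in Y..Y + U, cexp (((ν l * y : ℝ) : ℂ) * I)) := by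
    intro U
    rw [intervalIntegral.integral_finsetSum, Finset.mul_sum]
    · refine Finset.sum_congr rfl fun l _ ↦ ?_
      rw [intervalIntegral.integral_const_mul]
      ring
    · intro l _
      exact (by fun_prop : Continuous fun y : ℝ ↦ b l * cexp (((ν l * y : ℝ) : ℂ) * I)).intervalIntegrable _ _
  simp_rw [heq]
  rw [Finset.sum_filter]
  refine tendsto_finsetSum _ fun l _ ↦ ?_
  have h := (tendsto_mean_cexp (ν l) Y).const_mul (b l)
  simpa only [mul_ite, mul_one, mul_zero] using h

section Means

variable {κ : Type*} [Fintype κ] [DecidableEq κ]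

/-- **Mean value of the weight**: `U⁻¹ ∫_Y^{Y+U} Q → Re Σ_{c : Σ_j c_jλ_j = 0} W_c`.
[cite: BestTrudgian2015, Theorem 2 (proof)] -/
theorem tendsto_mean_fejerProd (N : κ → ℕ) (lam θ : κ → ℝ) (Y : ℝ) :
    Tendsto (fun U : ℝ ↦ U⁻¹ * ∫ y in Y..Y + U, fejerProd N lam θ y) atTop
      (𝓝 (∑ c ∈ coeffBox N with freq lam c = 0, prodWeight N θ c).re) := by
  have h := (Complex.continuous_re.tendsto _).comp
    (tendsto_mean_trigSum (coeffBox N) (prodWeight N θ) (freq lam) Y)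
  refine h.congr fun U ↦ ?_
  simp only [Function.comp_def]
  rw [← intervalIntegral.integral_congr (f := fun y : ℝ ↦ (fejerProd N lam θ y : ℂ))
      (fun y _ ↦ fejerProd_eq_sum N lam θ y),
    intervalIntegral.integral_ofReal, ← Complex.ofReal_inv, ← Complex.ofReal_mul, Complex.ofReal_re]

/-- **Mean value of the weight against an oscillating sum**: for `S(y) = Σᵢ bᵢ e^{iγᵢ y}`,
`U⁻¹ ∫_Y^{Y+U} Q · Re S → Re Σᵢ Σ_{c : Σ_j c_jλ_j + γᵢ = 0} W_c bᵢ`.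
[cite: BestTrudgian2015, Theorem 2 (proof)] -/
theorem tendsto_mean_fejerProd_mul_re {ι : Type*} (P : Finset ι) (γ : ι → ℝ) (b : ι → ℂ)
    (N : κ → ℕ) (lam θ : κ → ℝ) (Y : ℝ) :
    Tendsto (fun U : ℝ ↦ U⁻¹ * ∫ y in Y..Y + U,
        fejerProd N lam θ y * (∑ i ∈ P, b i * cexp (((γ i * y : ℝ) : ℂ) * I)).re) atTop
      (𝓝 (∑ i ∈ P, ∑ c ∈ coeffBox N with freq lam c + γ i = 0, prodWeight N θ c * b i).re) := by
  -- `Q · S` as one trigonometric sum over `P × box`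
  set b' : ι × (κ → ℤ) → ℂ := fun p ↦ prodWeight N θ p.2 * b p.1 with hb'
  set ν : ι × (κ → ℤ) → ℝ := fun p ↦ freq lam p.2 + γ p.1 with hν
  have hprod : ∀ y : ℝ, (fejerProd N lam θ y : ℂ) * ∑ i ∈ P, b i * cexp (((γ i * y : ℝ) : ℂ) * I) =
      ∑ p ∈ P ×ˢ coeffBox N, b' p * cexp (((ν p * y : ℝ) : ℂ) * I) := by
    intro y
    rw [fejerProd_eq_sum, Finset.sum_mul_sum, Finset.sum_comm, Finset.sum_product]
    refine Finset.sum_congr rfl fun i _ ↦ Finset.sum_congr rfl fun c _ ↦ ?_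
    simp only [hb', hν]
    rw [show ((freq lam c + γ i) * y : ℝ) = freq lam c * y + γ i * y by ring]
    push_cast
    rw [add_mul, Complex.exp_add]
    ring
  -- the limit of the complex means, and its real part
  have hlim := tendsto_mean_trigSum (P ×ˢ coeffBox N) b' ν Y
  have hfilt : ∑ p ∈ P ×ˢ coeffBox N with ν p = 0, b' p =
      ∑ i ∈ P, ∑ c ∈ coeffBox N with freq lam c + γ i = 0, prodWeight N θ c * b i := by
    rw [Finset.sum_filter, Finset.sum_product]
    refine Finset.sum_congr rfl fun i _ ↦ ?_
    rw [Finset.sum_filter]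
  rw [hfilt] at hlim
  have h := (Complex.continuous_re.tendsto _).comp hlim
  refine h.congr fun U ↦ ?_
  simp only [Function.comp_def]
  have hcont : Continuous fun y : ℝ ↦
      (fejerProd N lam θ y : ℂ) * ∑ i ∈ P, b i * cexp (((γ i * y : ℝ) : ℂ) * I) := by
    refine (Complex.continuous_ofReal.comp (continuous_fejerProd N lam θ)).mul ?_
    exact continuous_finsetSum _ fun i _ ↦ by fun_prop
  rw [← intervalIntegral.integral_congr (fun y _ ↦ hprod y), ← Complex.ofReal_inv,
    Complex.re_ofReal_mul, ← Complex.reCLM_apply (∫ y in Y..Y + U, _),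
    ← ContinuousLinearMap.intervalIntegral_comp_comm _ (hcont.intervalIntegrable _ _)]
  congr 1
  refine intervalIntegral.integral_congr fun y _ ↦ ?_
  simp only [Complex.reCLM_apply, Complex.re_ofReal_mul]

end Means

end AndersonStark
end Literature.NumberTheory.LFunctions

end
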